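import Mathlib.Algebra.Polynomial.Derivation
import Mathlib.Algebra.Polynomial.Degree.Lemmas
import Mathlib.RingTheory.MvPolynomial.EulerIdentity
import Literature.Computability.AlgebraicComplexity.SmoothFormAnnihilatorSemisimple
import Literature.Computability.AlgebraicComplexity.BI17FiniteStabilizerLocusProofs
import Literature.Computability.AlgebraicComplexity.Poonen05HypersurfaceLinearAutomorphisms
import HarnessLib

/-!
# Smooth forms of degree `≥ 3` have finite linear stabiliser over `ℂ` (Matsumura–Monsky, Poonen Thm. 2)

Classical theorem (Matsumura–Monsky 1964, Thm. 1 [MatsumuraMonsky1963]; Poonen 2005, Thm. 2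
[Poonen2005], p0002:L9 of the held text `paper:doi-10-1016-j-ffa-2004-12-001`: «If `n ≥ 1` and
`d ≥ 3`, then `Lin X` is finite»; proof p0002:L11: «See the "Historical Remarks" section at the
end of [OS]. The result has apparently been known for at least one hundred years, at least when
`p = 0`. Matsumura and Monsky [MM] give a proof in arbitrary characteristic, at least when
`n ≥ 2` …»). In the tree this is the open fact `poonen2005_thm_2`
(`Poonen05HypersurfaceLinearAutomorphisms.lean`; every algebraically closed field, any
characteristic). This file PROVES THE CASE `K = ℂ`, sorry-free and with no new facts:

* `glAnn_eq_bot_of_isNonsingularForm` — for a nonsingular form `F ∈ ℂ[x₀,…,x_{n+1}]`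
  (`IsNonsingularForm`, Hartshorne I Ex. 5.8) of degree `d ≥ 3`, the annihilator
  `𝔤𝔩(W)_F = {X : Σ X_{ab} x_a ∂_b F = 0}` (the Lie algebra of the stabiliser) is zero;
* `finite_linStabilizer_of_isNonsingularForm` — hence (t13's `finite_linStabilizer_iff_glAnn_eq_bot`,
  `BI17FiniteStabilizerLocusProofs.lean`) the stabiliser `{γ ∈ GL_{n+2}(ℂ) | γ·F = F}` is finite;
* `poonen2005_thm_2_complex` — the statement of `poonen2005_thm_2` specialised to `K = ℂ`
  (projective symmetry group `𝔾_F` = scalar multiples of finitely many matrices), via x3's bridge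
  `exists_smul_mem_linStabilizer_of_mem_projLinStabilizer`;
* `affineDimension_orbitClosure_of_isNonsingularForm` — corollary: the orbit closure
  `\overline{GL_{n+2}·F}` of a smooth form of degree `≥ 3` has the full dimension `(n+2)²`;
  `orbitClosure_eq_of_mem_of_isNonsingularForm` — smooth forms of degree `≥ 3` are not proper
  degenerations (`P ∈ Δ(Q)` forces `Δ(P) = Δ(Q)` and `𝔤𝔩(W)_Q = 0`); in particular
  (`not_mem_orbitClosure_of_glAnn_ne_bot`) orbit closures of forms with `𝔤𝔩(W)_Q ≠ 0` contain no
  smooth forms of degree `≥ 3`.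

Typed vs printed: `poonen2005_thm_2` itself (all algebraically closed `K`, any characteristic) is
NOT discharged — only its `ℂ`-instance is proved (the Lie-algebra criterion is a characteristic-0
tool). Honest framing: classical invariant theory; nothing here bears on VP versus VNP.

## Route (elementary and infinitesimal; not the printed proofs via [OS]/[MM])

By `isNilpotent_of_mem_glAnn_of_isNonsingularForm` (`SmoothFormAnnihilatorSemisimple.lean`, the
semisimple half: weights of a diagonalisable element) every `X ∈ 𝔤𝔩(W)_F` is nilpotent. The
NILPOTENT HALF (`eq_zero_of_mem_glAnn_of_isNilpotent`): let `N ∈ 𝔤𝔩(W)_F`, `N ≠ 0`, with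
nilpotency class `r + 1 ≥ 2`.
1. (`exists_flow`) The truncated exponential `w(t) = exp(tNᵀ)x ∈ ℂ[x][t]^{n+2}` solves `w' = Nᵀw`
   coordinatewise (`∂ₜ w_a = Σ_c N_{ca} w_c`), has `t`-degree `≤ r` and top coefficient
   `(1/r!)(Nᵀ)^r x`.
2. (`derivative_aeval_eq_aeval_glTangentMap`) Chain rule: `∂ₜ G(w) = (N·G)(w)` for every `G`.
3. (`glTangentMap_pderiv_eq_neg_sum`) Differentiating `N·F = 0`: `N·(∂_c F) = -Σ_b N_{cb} ∂_b F`, so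
   `Γ_c := (∂_c F)(w)` solves the linear system `Γ' = -NΓ`; as `N^{r+1} = 0`, `∂ₜ^{r+1} Γ = 0`,
   i.e. every `Γ_c` has `t`-degree `≤ r` (`coeff_iterate_derivative`, characteristic `0`).
4. (`aeval_pow_pderiv_eq_zero_of_mem_glAnn`) But `∂_c F` is a form of degree `d - 1 ≥ 2`, so the
   `t^{(d-1)r}`-coefficient of `Γ_c` is `(∂_c F)((1/r!)(Nᵀ)^r x)`; since `(d-1)r ≥ r + 1` it
   vanishes: all partials vanish identically on the image of `(Nᵀ)^r ≠ 0`.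
5. A nonzero point of that image is then a common zero of all `∂_c F`, hence of `F` (Euler) — a
   singular point, contradicting nonsingularity. (Classically: a smooth hypersurface of degree
   `≥ 3` admits no `𝔾ₐ` and no `𝔾ₘ` of linear automorphisms, and `𝔤𝔩(W)_F` is algebraic.)

## References

* B. Poonen, *Varieties without extra automorphisms III: hypersurfaces*, Finite Fields Appl. 11
  (2005) 230–268, Thm. 2. [Poonen2005]
* H. Matsumura, P. Monsky, *On the automorphisms of hypersurfaces*, J. Math. Kyoto Univ. 3
  (1963/64) 347–361, Thm. 1 (not held; quoted after Poonen). [MatsumuraMonsky1963]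
* R. Hartshorne, *Algebraic Geometry*, GTM 52 (1977), I Ex. 5.8. [Hartshorne1977]
-/

noncomputable section

open MvPolynomial Matrix

namespace Literature.Computability.AlgebraicComplexity

section Flow

variable {σ : Type*} [Fintype σ] [DecidableEq σ]

/-- Chain rule for a derivation through a polynomial substitution:
`δ (G(w)) = Σᵢ (∂ᵢG)(w) · δ(wᵢ)`. [folklore] -/
private theorem derivation_aeval_eq_sum {R A : Type*} [CommRing R] [CommRing A] [Algebra R A]
    (δ : Derivation R A A) (w : σ → A) (G : MvPolynomial σ R) :
    δ (aeval w G) = ∑ i, aeval w (pderiv i G) * δ (w i) := by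
  induction G using MvPolynomial.induction_on with
  | C c => simp
  | add p q hp hq => simp only [map_add, hp, hq, add_mul, Finset.sum_add_distrib]
  | mul_X p i hp =>
    have key : ∀ j, aeval w (pderiv j (p * X i)) * δ (w j) =
        w i * (aeval w (pderiv j p) * δ (w j)) + (if j = i then aeval w p * δ (w i) else 0) := by
      intro j
      rw [Derivation.leibniz, pderiv_X, smul_eq_mul, smul_eq_mul, map_add, map_mul, map_mul, aeval_X]
      by_cases hji : j = i
      · subst hji; rw [Pi.single_eq_same, map_one, if_pos rfl]; ring
      · rw [Pi.single_eq_of_ne (Ne.symm hji), map_zero, if_neg hji]; ring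
    rw [map_mul, aeval_X, Derivation.leibniz, hp, smul_eq_mul, smul_eq_mul]
    simp_rw [key]
    rw [Finset.sum_add_distrib, Finset.sum_ite_eq' Finset.univ i, if_pos (Finset.mem_univ _),
      Finset.mul_sum]
    ring

/-- **Derivative along the flow**: if `w' = L w` (i.e. `∂ₜ w_a = Σ_c L_{ac} w_c`) then for
every polynomial `G`, `∂ₜ G(w) = (N·G)(w)` with `N = Lᵀ` (`N·G = Σ N_{ab} x_a ∂_b G`).
[cite: Poonen2005, Thm. 2 (p0002:L9); proof step, not in the source] -/
theorem derivative_aeval_eq_aeval_glTangentMap (N : Matrix σ σ ℂ)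
    (w : σ → Polynomial (MvPolynomial σ ℂ))
    (hw : ∀ a, Polynomial.derivative (w a) = ∑ c, N c a • w c) (G : MvPolynomial σ ℂ) :
    Polynomial.derivative (aeval w G) = aeval w (glTangentMap G N) := by
  have h1 : Polynomial.derivative (aeval w G) = ∑ i, aeval w (pderiv i G) * Polynomial.derivative (w i) := by
    have := derivation_aeval_eq_sum ((Polynomial.derivative' :
      Derivation (MvPolynomial σ ℂ) (Polynomial (MvPolynomial σ ℂ)) (Polynomial (MvPolynomial σ ℂ))).restrictScalars ℂ) w G
    simpa using this
  rw [h1, glTangentMap_apply, map_sum]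
  simp_rw [hw, Finset.mul_sum, map_sum, map_smul, map_mul, aeval_X]
  rw [Finset.sum_comm]
  refine Finset.sum_congr rfl fun a _ => Finset.sum_congr rfl fun b _ => ?_
  rw [mul_smul_comm, mul_comm]

/-- **The truncated exponential flow.** For `N` with `N^{r+1} = 0`, the vector
`w_a(t) = Σ_{k ≤ r} (t^k/k!) Σ_j (N^k)_{ja} x_j ∈ ℂ[x][t]` (i.e. `w(t) = exp(t Nᵀ) x`) satisfies
`∂ₜ w_a = Σ_c N_{ca} w_c`, has `t`-degree `≤ r`, and `t^r`-coefficient `(1/r!) Σ_j (N^r)_{ja} x_j`.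
[cite: Poonen2005, Thm. 2 (p0002:L9); proof step, not in the source] -/
theorem exists_flow (N : Matrix σ σ ℂ) (r : ℕ) (hN : N ^ (r + 1) = 0) :
    ∃ w : σ → Polynomial (MvPolynomial σ ℂ),
      (∀ a, Polynomial.derivative (w a) = ∑ c, N c a • w c) ∧
      (∀ a, (w a).natDegree ≤ r) ∧
      (∀ a, (w a).coeff r = ∑ j, (((r.factorial : ℂ)⁻¹ * (N ^ r) j a)) • (X j : MvPolynomial σ ℂ)) := by
  let u : ℕ → σ → MvPolynomial σ ℂ :=
    fun k a => ∑ j, (((k.factorial : ℂ)⁻¹ * (N ^ k) j a)) • (X j : MvPolynomial σ ℂ)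
  -- the recursion `Σ_c N_{ca} u_k(c) = (k+1) · u_{k+1}(a)`
  have hrec : ∀ k a, ∑ c, N c a • u k c =
      u (k + 1) a * ((k + 1 : ℕ) : MvPolynomial σ ℂ) := by
    intro k a
    have lhs : ∑ c, N c a • u k c =
        ∑ j, (((k.factorial : ℂ)⁻¹ * (N ^ (k + 1)) j a)) • (X j : MvPolynomial σ ℂ) := by
      simp only [u, Finset.smul_sum, smul_smul]
      rw [Finset.sum_comm]
      refine Finset.sum_congr rfl fun j _ => ?_
      rw [← Finset.sum_smul, pow_succ, Matrix.mul_apply, Finset.mul_sum]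
      congr 1
      refine Finset.sum_congr rfl fun c _ => ?_
      ring
    have rhs : u (k + 1) a * ((k + 1 : ℕ) : MvPolynomial σ ℂ) =
        ∑ j, (((k.factorial : ℂ)⁻¹ * (N ^ (k + 1)) j a)) • (X j : MvPolynomial σ ℂ) := by
      simp only [u, Finset.sum_mul]
      refine Finset.sum_congr rfl fun j _ => ?_
      rw [← map_natCast (C : ℂ →+* MvPolynomial σ ℂ), mul_comm, ← smul_eq_C_mul, smul_smul]
      congr 1
      have hk : (k.factorial : ℂ) ≠ 0 := by exact_mod_cast k.factorial_ne_zero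
      have hk1 : ((k + 1).factorial : ℂ) ≠ 0 := by exact_mod_cast (k + 1).factorial_ne_zero
      rw [Nat.factorial_succ] at hk1 ⊢
      push_cast at hk1 ⊢
      field_simp
    rw [lhs, rhs]
  have hu_top : u (r + 1) = 0 := by
    funext a
    simp [u, hN]
  refine ⟨fun a => ∑ k ∈ Finset.range (r + 1), Polynomial.C (u k a) * Polynomial.X ^ k, ?_, ?_, ?_⟩
  · intro a
    rw [Polynomial.derivative_sum]
    simp_rw [Polynomial.derivative_C_mul_X_pow]
    rw [Finset.sum_range_succ', Nat.cast_zero, mul_zero, map_zero, zero_mul, add_zero]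
    -- right-hand side
    have hR : ∑ c, N c a • ∑ k ∈ Finset.range (r + 1), Polynomial.C (u k c) * Polynomial.X ^ k =
        ∑ k ∈ Finset.range (r + 1), Polynomial.C (∑ c, N c a • u k c) * Polynomial.X ^ k := by
      simp_rw [Finset.smul_sum]
      rw [Finset.sum_comm]
      refine Finset.sum_congr rfl fun k _ => ?_
      rw [map_sum, Finset.sum_mul]
      refine Finset.sum_congr rfl fun c _ => ?_
      rw [← Polynomial.smul_C, smul_mul_assoc]
    rw [hR, Finset.sum_range_succ, hrec r a, hu_top, Pi.zero_apply, zero_mul, map_zero, zero_mul,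
      add_zero]
    refine Finset.sum_congr rfl fun k _ => ?_
    rw [hrec k a, Nat.add_sub_cancel]
  · intro a
    refine Polynomial.natDegree_sum_le_of_forall_le _ _ fun k hk => ?_
    exact (Polynomial.natDegree_C_mul_X_pow_le _ _).trans (Nat.lt_succ_iff.mp (Finset.mem_range.mp hk))
  · intro a
    rw [Polynomial.finsetSum_coeff]
    simp_rw [Polynomial.coeff_C_mul_X_pow]
    rw [Finset.sum_ite_eq (Finset.range (r + 1)) r, if_pos (Finset.mem_range.mpr (Nat.lt_succ_self r))]

omit [Fintype σ] in
/-- **Top coefficient of a form along a polynomial curve**: if every `w_a(t)` has degree `≤ r`,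
then for a form `G` of degree `e` the `t^{er}`-coefficient of `G(w(t))` is `G` evaluated at the
top coefficients. [folklore] -/
private theorem coeff_aeval_mul_of_isHomogeneous (w : σ → Polynomial (MvPolynomial σ ℂ)) (r : ℕ)
    (hw : ∀ a, (w a).natDegree ≤ r) {G : MvPolynomial σ ℂ} {e : ℕ} (hG : G.IsHomogeneous e) :
    (aeval w G).coeff (e * r) = aeval (fun a => (w a).coeff r) G := by
  classical
  -- product lemma over a finset with individual degree bounds
  have hprod : ∀ (s : Finset σ) (m : σ → ℕ),
      (∏ i ∈ s, w i ^ m i).natDegree ≤ (∑ i ∈ s, m i) * r ∧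
      (∏ i ∈ s, w i ^ m i).coeff ((∑ i ∈ s, m i) * r) = ∏ i ∈ s, (w i).coeff r ^ m i := by
    intro s m
    induction s using Finset.induction_on with
    | empty => simp
    | insert i s hi ih =>
      rw [Finset.prod_insert hi, Finset.prod_insert hi, Finset.sum_insert hi, add_mul]
      have hdeg : (w i ^ m i).natDegree ≤ m i * r := Polynomial.natDegree_pow_le_of_le _ (hw i)
      refine ⟨Polynomial.natDegree_mul_le_of_le hdeg ih.1, ?_⟩
      rw [Polynomial.coeff_mul_add_eq_of_natDegree_le hdeg ih.1, ih.2,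
        Polynomial.coeff_pow_of_natDegree_le (hw i)]
  conv_lhs => rw [G.as_sum, map_sum, Polynomial.finsetSum_coeff]
  conv_rhs => rw [G.as_sum, map_sum]
  refine Finset.sum_congr rfl fun m hm => ?_
  rw [aeval_monomial, aeval_monomial, Finsupp.prod, Finsupp.prod]
  have hdegm : ∑ i ∈ m.support, m i = e := by
    have := hG (mem_support_iff.mp hm)
    rw [Finsupp.weight_apply, Finsupp.sum] at this
    simpa using this
  obtain ⟨-, h2⟩ := hprod m.support m
  rw [hdegm] at h2
  rw [Polynomial.algebraMap_apply, Polynomial.coeff_C_mul, h2, MvPolynomial.algebraMap_eq]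

end Flow

/-! ### The partial derivatives along the flow and the nilpotent half -/

section NilpotentHalf

variable {σ : Type*} [Fintype σ] [DecidableEq σ]

omit [Fintype σ] in
/-- Partial derivatives commute. [folklore] -/
private theorem pderiv_pderiv_comm' (i j : σ) (p : MvPolynomial σ ℂ) :
    pderiv i (pderiv j p) = pderiv j (pderiv i p) := by
  classical
  rcases eq_or_ne i j with rfl | hij
  · rfl
  ext m
  simp only [coeff_pderiv, Finsupp.add_apply, Finsupp.single_apply, if_neg hij,
    if_neg hij.symm, add_zero]
  rw [add_right_comm m (Finsupp.single i 1) (Finsupp.single j 1)]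
  ring

/-- **The gradient is an `N`-module**: if `N·F = 0` then `N·(∂_c F) = -Σ_b N_{cb} ∂_b F`
(differentiate `Σ N_{ab} x_a ∂_b F = 0` with respect to `x_c`).
[cite: Poonen2005, Thm. 2 (p0002:L9); proof step, not in the source] -/
theorem glTangentMap_pderiv_eq_neg_sum {F : MvPolynomial σ ℂ} {N : Matrix σ σ ℂ}
    (h : N ∈ glAnn F) (c : σ) :
    glTangentMap (pderiv c F) N = -∑ b, N c b • pderiv b F := by
  have h0 : pderiv c (glTangentMap F N) = 0 := by
    have : glTangentMap F N = 0 := by simpa [glAnn] using h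
    rw [this, map_zero]
  rw [glTangentMap_apply, map_sum] at h0
  simp_rw [map_sum, Derivation.map_smul, Derivation.leibniz, pderiv_X, smul_eq_mul, smul_add,
    Finset.sum_add_distrib] at h0
  have h1 : ∑ a, ∑ b, N a b • ((X a : MvPolynomial σ ℂ) * pderiv c (pderiv b F)) =
      glTangentMap (pderiv c F) N := by
    rw [glTangentMap_apply]
    simp_rw [pderiv_pderiv_comm' c]
  have h2 : ∑ a, ∑ b, N a b • (pderiv b F * (Pi.single c (1 : MvPolynomial σ ℂ) : σ → _) a) =
      ∑ b, N c b • pderiv b F := by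
    rw [Finset.sum_eq_single c (fun a _ hac => by simp [Pi.single_eq_of_ne hac])
      (fun h => absurd (Finset.mem_univ c) h)]
    simp
  rw [h1, h2] at h0
  exact eq_neg_of_add_eq_zero_left h0

omit [Fintype σ] [DecidableEq σ] in
/-- `n • x = 0 → x = 0` in `ℂ[x]`. [folklore] -/
private theorem eq_zero_of_nsmul_eq_zero {n : ℕ} (hn : n ≠ 0) {x : MvPolynomial σ ℂ}
    (h : n • x = 0) : x = 0 := by
  rw [nsmul_eq_mul, mul_eq_zero] at h
  exact h.resolve_left (by exact_mod_cast hn)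

/-- **Engine of the nilpotent half.** Let `N ∈ 𝔤𝔩(W)_F` with `N^{r+1} = 0`, and let `∂_c F` be a
form of degree `e` with `r + 1 ≤ e·r`. Then `∂_c F` vanishes identically on the image of
`(Nᵀ)^r`: `(∂_c F)((1/r!)·(Nᵀ)^r x) = 0`. Mechanism: along the flow `w(t) = exp(tNᵀ)x` the vector
`Γ_c(t) = (∂_c F)(w(t))` solves `Γ' = -NΓ`, so its `t`-degree is `≤ r`, while its
`t^{er}`-coefficient is `(∂_c F)` at the top coefficient `(1/r!)(Nᵀ)^r x` of `w`.
[cite: Poonen2005, Thm. 2 (p0002:L9); proof step, not in the source] -/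
theorem aeval_pow_pderiv_eq_zero_of_mem_glAnn {F : MvPolynomial σ ℂ} {N : Matrix σ σ ℂ}
    (h : N ∈ glAnn F) {r : ℕ} (hN : N ^ (r + 1) = 0) {e : ℕ} (c : σ)
    (he : (pderiv c F).IsHomogeneous e) (her : r + 1 ≤ e * r) :
    aeval (fun a => ∑ j, (((r.factorial : ℂ)⁻¹ * (N ^ r) j a)) • (X j : MvPolynomial σ ℂ))
      (pderiv c F) = 0 := by
  obtain ⟨w, hw1, hw2, hw3⟩ := exists_flow N r hN
  -- the vector `Γ_b = (∂_b F)(w)` solves `Γ' = -N Γ`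
  have hΓ : ∀ b, Polynomial.derivative (aeval w (pderiv b F)) =
      ∑ b', (-N) b b' • aeval w (pderiv b' F) := by
    intro b
    rw [derivative_aeval_eq_aeval_glTangentMap N w hw1, glTangentMap_pderiv_eq_neg_sum h, map_neg,
      map_sum, ← Finset.sum_neg_distrib]
    refine Finset.sum_congr rfl fun b' _ => ?_
    rw [map_smul, Matrix.neg_apply, neg_smul]
  have hiter : ∀ k b, Polynomial.derivative^[k] (aeval w (pderiv b F)) =
      ∑ b', ((-N) ^ k) b b' • aeval w (pderiv b' F) := by
    intro k
    induction k with
    | zero =>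
      intro b
      rw [Function.iterate_zero_apply, pow_zero,
        Finset.sum_eq_single b (fun b' _ hb' => by rw [Matrix.one_apply_ne (Ne.symm hb'), zero_smul])
          (fun h => absurd (Finset.mem_univ b) h), Matrix.one_apply_eq, one_smul]
    | succ k ih =>
      intro b
      rw [Function.iterate_succ_apply', ih, map_sum]
      simp_rw [Polynomial.derivative_smul, hΓ, Finset.smul_sum, smul_smul]
      rw [Finset.sum_comm]
      refine Finset.sum_congr rfl fun b' _ => ?_
      rw [← Finset.sum_smul, pow_succ, Matrix.mul_apply]
  -- hence all coefficients of index `≥ r + 1` vanish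
  have hvan : ∀ m, r + 1 ≤ m → (aeval w (pderiv c F)).coeff m = 0 := by
    intro m hm
    have h1 : Polynomial.derivative^[r + 1] (aeval w (pderiv c F)) = 0 := by
      rw [hiter, neg_pow, hN, mul_zero]
      simp
    have h2 := Polynomial.coeff_iterate_derivative (k := r + 1) (aeval w (pderiv c F)) (m - (r + 1))
    rw [h1, Polynomial.coeff_zero, Nat.sub_add_cancel hm] at h2
    exact eq_zero_of_nsmul_eq_zero ((Nat.descFactorial_eq_zero_iff_lt.not).mpr (not_lt.mpr hm))
      h2.symm
  -- while the top coefficient is `∂_c F` at the top of the flow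
  have htop := coeff_aeval_mul_of_isHomogeneous w r hw2 he
  rw [hvan _ her] at htop
  have hfun : (fun a => (w a).coeff r) =
      fun a => ∑ j, (((r.factorial : ℂ)⁻¹ * (N ^ r) j a)) • (X j : MvPolynomial σ ℂ) :=
    funext hw3
  rw [← hfun]
  exact htop.symm

end NilpotentHalf

/-! ### Smooth forms of degree `≥ 3`: `𝔤𝔩(W)_F = 0`, finite stabiliser, Poonen's Theorem 2 over `ℂ` -/

section Smooth

open Literature.AlgebraicGeometry.Motives.SmoothHypersurface

variable {n : ℕ}

/-- Easy half of the Jacobian criterion: a nonsingular form and its partials have no common zero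
`z ≠ 0`. [cite: Hartshorne1977, I Ex. 5.8] -/
private theorem exists_eval_pderiv_ne_zero' {F : MvPolynomial (Fin (n + 2)) ℂ}
    (hF : IsNonsingularForm ℂ F) {z : Fin (n + 2) → ℂ} (hz : z ≠ 0) (hFz : eval z F = 0) :
    ∃ j, eval z (pderiv j F) ≠ 0 := by
  by_contra h
  push Not at h
  apply hz
  funext i
  have hX := hF (RingHom.ker (eval z)) (RingHom.ker_isPrime _) (by simpa using hFz)
    (fun j => by simpa using h j) i
  simpa using hX

/-- **The nilpotent half.** A NILPOTENT element of the annihilator `𝔤𝔩(W)_F` of a nonsingular form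
`F ∈ ℂ[x₀,…,x_{n+1}]` of degree `d ≥ 3` is zero: otherwise, with `r + 1` the nilpotency class of
`N`, every partial `∂_c F` (a form of degree `d - 1 ≥ 2`, and `(d-1)r ≥ r+1`) vanishes on the image
of `(Nᵀ)^r ≠ 0` (`aeval_pow_pderiv_eq_zero_of_mem_glAnn`), and by Euler so does `F` — a singular
point. Classically: a smooth hypersurface of degree `≥ 3` admits no `𝔾ₐ` of linear automorphisms.
[cite: Poonen2005, Thm. 2 (p0002:L9); infinitesimal nilpotent case — not the printed proof] -/
theorem eq_zero_of_mem_glAnn_of_isNilpotent {F : MvPolynomial (Fin (n + 2)) ℂ}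
    (hF : IsNonsingularForm ℂ F) {d : ℕ} (hFd : F.IsHomogeneous d) (hd : 3 ≤ d)
    {N : Matrix (Fin (n + 2)) (Fin (n + 2)) ℂ} (hN : IsNilpotent N) (hmem : N ∈ glAnn F) :
    N = 0 := by
  by_contra hN0
  -- nilpotency class `p = r + 1 ≥ 2`
  set p := nilpotencyClass N with hp
  have hNp : N ^ p = 0 := pow_nilpotencyClass hN
  have hNp1 : N ^ (p - 1) ≠ 0 := pow_pred_nilpotencyClass hN
  have hp2 : 2 ≤ p := by
    by_contra hlt
    push Not at hlt
    interval_cases p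
    · rw [pow_zero] at hNp; exact one_ne_zero hNp
    · rw [pow_one] at hNp; exact hN0 hNp
  obtain ⟨r, hr⟩ : ∃ r, p = r + 1 := ⟨p - 1, by omega⟩
  have hr1 : 1 ≤ r := by omega
  rw [hr] at hNp hNp1
  simp only [Nat.add_sub_cancel] at hNp1
  -- every partial vanishes on the image of `(1/r!) (Nᵀ)^r`
  set u : Fin (n + 2) → MvPolynomial (Fin (n + 2)) ℂ :=
    fun a => ∑ j, (((r.factorial : ℂ)⁻¹ * (N ^ r) j a)) • (X j : MvPolynomial (Fin (n + 2)) ℂ)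
    with hu
  have her : r + 1 ≤ (d - 1) * r := by
    have h2 : 2 ≤ d - 1 := by omega
    calc r + 1 ≤ 2 * r := by omega
      _ ≤ (d - 1) * r := Nat.mul_le_mul_right r h2
  have hpart : ∀ c, aeval u (pderiv c F) = 0 := fun c =>
    aeval_pow_pderiv_eq_zero_of_mem_glAnn hmem hNp c hFd.pderiv her
  -- a nonzero point in that image
  obtain ⟨j₀, a₀, hja⟩ : ∃ j a, (N ^ r) j a ≠ 0 := by
    by_contra hcon
    push Not at hcon
    exact hNp1 (Matrix.ext fun j a => by simpa using hcon j a)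
  set y : Fin (n + 2) → ℂ := Pi.single j₀ 1 with hy
  set v : Fin (n + 2) → ℂ := fun a => eval y (u a) with hv
  have hv_apply : ∀ a, v a = (r.factorial : ℂ)⁻¹ * (N ^ r) j₀ a := by
    intro a
    simp only [hv, hu, map_sum, smul_eval, eval_X, hy]
    rw [Finset.sum_eq_single j₀ (fun j _ hj => by rw [Pi.single_eq_of_ne hj, mul_zero])
      (fun h => absurd (Finset.mem_univ j₀) h), Pi.single_eq_same, mul_one]
  have hv0 : v ≠ 0 := by
    intro h0
    have := congr_fun h0 a₀
    rw [hv_apply, Pi.zero_apply, mul_eq_zero] at this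
    rcases this with h1 | h1
    · exact (inv_ne_zero (by exact_mod_cast r.factorial_ne_zero)) h1
    · exact hja h1
  -- all partials vanish at `v`, hence so does `F` (Euler)
  have heval : ∀ G : MvPolynomial (Fin (n + 2)) ℂ, eval y (aeval u G) = eval v G := by
    intro G
    rw [aeval_eq_bind₁]
    exact eval₂Hom_bind₁ (RingHom.id ℂ) y u G
  have hdv : ∀ c, eval v (pderiv c F) = 0 := by
    intro c
    rw [← heval, hpart c, map_zero]
  have hFv : eval v F = 0 := by
    have hE := congr_arg (eval v) hFd.sum_X_mul_pderiv
    rw [map_sum, map_nsmul] at hE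
    simp only [map_mul, hdv, mul_zero, Finset.sum_const_zero] at hE
    rw [nsmul_eq_mul, eq_comm, mul_eq_zero] at hE
    exact hE.resolve_left (by exact_mod_cast (show d ≠ 0 by omega))
  obtain ⟨j, hj⟩ := exists_eval_pderiv_ne_zero' hF hv0 hFv
  exact hj (hdv j)

/-- **`𝔤𝔩(W)_F = 0` for a smooth form of degree `≥ 3`** (infinitesimal Matsumura–Monsky): every
element of the annihilator is nilpotent (`isNilpotent_of_mem_glAnn_of_isNonsingularForm`, the
semisimple half) and every nilpotent element vanishes (`eq_zero_of_mem_glAnn_of_isNilpotent`).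
[cite: Poonen2005, Thm. 2 (p0002:L9); Lie-algebra form over ℂ — not the printed proof] -/
theorem glAnn_eq_bot_of_isNonsingularForm {F : MvPolynomial (Fin (n + 2)) ℂ}
    (hF : IsNonsingularForm ℂ F) {d : ℕ} (hFd : F.IsHomogeneous d) (hd : 3 ≤ d) :
    glAnn F = ⊥ := by
  rw [eq_bot_iff]
  intro X hX
  rw [Submodule.mem_bot]
  exact eq_zero_of_mem_glAnn_of_isNilpotent hF hFd hd
    (isNilpotent_of_mem_glAnn_of_isNonsingularForm hF hFd hd hX) hX

/-- **Matsumura–Monsky / Poonen finiteness over `ℂ`, stabiliser form**: a nonsingular form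
`F ∈ ℂ[x₀,…,x_{n+1}]` of degree `d ≥ 3` has a FINITE stabiliser `{γ ∈ GL_{n+2}(ℂ) | γ·F = F}`
(`𝔤𝔩(W)_F = 0` and `finite_linStabilizer_iff_glAnn_eq_bot`). Typed vs printed: Poonen's Theorem 2
is stated for `n ≥ 1` over any algebraically closed field and for `Lin X = 𝔾_F/scalars`; this is
the case `K = ℂ` (all `n ≥ 0`) for the linear stabiliser; see `poonen2005_thm_2_complex` for the
printed shape. [cite: Poonen2005, Thm. 2 (p0002:L9)] -/
theorem finite_linStabilizer_of_isNonsingularForm {F : MvPolynomial (Fin (n + 2)) ℂ}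
    (hF : IsNonsingularForm ℂ F) {d : ℕ} (hFd : F.IsHomogeneous d) (hd : 3 ≤ d) :
    Finite (linStabilizer F) :=
  (finite_linStabilizer_iff_glAnn_eq_bot hFd).mpr (glAnn_eq_bot_of_isNonsingularForm hF hFd hd)

/-- **Poonen 2005, Theorem 2, over `ℂ`** («If `n ≥ 1` and `d ≥ 3`, then `Lin X` is finite»,
p0002:L9), in the exact shape of the tree's fact `poonen2005_thm_2` specialised to `K = ℂ`: for a
smooth hypersurface `X = V(F) ⊂ ℙ^{n+1}_ℂ` of degree `d ≥ 3`, the projective symmetry group `𝔾_F`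
consists of the scalar multiples of finitely many matrices. From the finite stabiliser and
`𝔾_F = ℂ^× · stab(F)` (`exists_smul_mem_linStabilizer_of_mem_projLinStabilizer`). Typed vs
printed: the fact `poonen2005_thm_2` quantifies over every algebraically closed field (any
characteristic) and is NOT discharged by this `ℂ`-instance; the hypothesis `1 ≤ n` is kept for the
printed shape but not used. [cite: Poonen2005, Thm. 2 (p0002:L9)] -/
theorem poonen2005_thm_2_complex (n d : ℕ) (_hn : 1 ≤ n) (hd : 3 ≤ d)
    (f : MvPolynomial (Fin (n + 2)) ℂ) (hf : f.IsHomogeneous d) (hns : IsNonsingularForm ℂ f) :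
    ∃ T : Finset (GL (Fin (n + 2)) ℂ), ∀ γ ∈ projLinStabilizer f, ∃ t ∈ T, ∃ c : ℂ,
      (γ : Matrix (Fin (n + 2)) (Fin (n + 2)) ℂ) = c • (t : Matrix (Fin (n + 2)) (Fin (n + 2)) ℂ) := by
  haveI := finite_linStabilizer_of_isNonsingularForm hns hf hd
  have hfin : (linStabilizer f : Set (GL (Fin (n + 2)) ℂ)).Finite := Set.toFinite _
  refine ⟨hfin.toFinset, fun γ hγ => ?_⟩
  obtain ⟨t, δ, ht, hδ, hδγ⟩ := exists_smul_mem_linStabilizer_of_mem_projLinStabilizer hf (by omega) hγ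
  refine ⟨δ, hfin.mem_toFinset.mpr hδ, t⁻¹, ?_⟩
  rw [hδγ, smul_smul, inv_mul_cancel₀ ht, one_smul]

/-- **Orbit closures of smooth forms are full-dimensional**: for a nonsingular form `F` of degree
`d ≥ 3` in `n + 2` variables, `dim \overline{GL_{n+2}·F} = (n+2)²` (`= dim GL_{n+2}`: the orbit map
has finite fibres), by `dim Δ(F) = N² − dim 𝔤𝔩(W)_F`
(`affineDimension_orbitClosure_eq_card_sq_sub_finrank_glAnn`) and `𝔤𝔩(W)_F = 0`. Typed vs printed:
a corollary of Poonen's Theorem 2 over `ℂ` in the orbit-closure language of the GCT files, not a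
statement of the source. [cite: Poonen2005, Thm. 2 (p0002:L9); corollary, not in the source] -/
theorem affineDimension_orbitClosure_of_isNonsingularForm {F : MvPolynomial (Fin (n + 2)) ℂ}
    (hF : IsNonsingularForm ℂ F) {d : ℕ} (hFd : F.IsHomogeneous d) (hd : 3 ≤ d) :
    affineDimension (formCoeff d '' orbitClosure F) = (n + 2) ^ 2 := by
  rw [affineDimension_orbitClosure_eq_card_sq_sub_finrank_glAnn hFd,
    glAnn_eq_bot_of_isNonsingularForm hF hFd hd, finrank_bot, Nat.sub_zero, Fintype.card_fin]

/-- The same in terms of the orbit-closure coordinate ring: `dim ℂ[Δ(F)] = (n+2)²` for a nonsingular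
form `F` of degree `d ≥ 3` (`ringKrullDim_orbitCoordRing_eq_affineDimension_orbitClosure`).
[cite: Poonen2005, Thm. 2 (p0002:L9); corollary, not in the source] -/
theorem ringKrullDim_orbitCoordRing_of_isNonsingularForm {F : MvPolynomial (Fin (n + 2)) ℂ}
    (hF : IsNonsingularForm ℂ F) {d : ℕ} (hFd : F.IsHomogeneous d) (hd : 3 ≤ d) :
    ringKrullDim (OrbitCoordRing F d) = (((n + 2) ^ 2 : ℕ) : WithBot ℕ∞) := by
  rw [ringKrullDim_orbitCoordRing_eq_affineDimension_orbitClosure hFd,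
    affineDimension_orbitClosure_of_isNonsingularForm hF hFd hd]

/-- **Smooth forms are not proper degenerations.** If a nonsingular form `P` of degree `d ≥ 3` lies
in the orbit closure `Δ(Q) = \overline{GL·Q}` of a form `Q ≠ 0` of degree `d`, then `Δ(P) = Δ(Q)`:
otherwise `Δ(P) ⊊ Δ(Q)` would give `dim Δ(P) + 1 ≤ dim Δ(Q)`
(`affineDimension_orbitClosure_add_one_le_of_ssubset`), but `dim Δ(P) = (n+2)²` is already the
maximum `(n+2)² − dim 𝔤𝔩(W)_Q ≥ dim Δ(Q)`. Typed vs printed: a corollary in the orbit-closure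
language of the GCT files, not a statement of the source. [cite: Poonen2005, Thm. 2 (p0002:L9);
corollary, not in the source] -/
theorem orbitClosure_eq_of_mem_of_isNonsingularForm {P Q : MvPolynomial (Fin (n + 2)) ℂ}
    (hP : IsNonsingularForm ℂ P) {d : ℕ} (hPd : P.IsHomogeneous d) (hd : 3 ≤ d)
    (hQd : Q.IsHomogeneous d) (hQ0 : Q ≠ 0) (h : P ∈ orbitClosure Q) :
    orbitClosure P = orbitClosure Q := by
  have hsub : orbitClosure P ⊆ orbitClosure Q := orbitClosure_subset_of_mem_holds h
  by_contra hne
  have hne' : ¬ orbitClosure Q ⊆ orbitClosure P := fun h' => hne (Set.Subset.antisymm hsub h')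
  have hlt := affineDimension_orbitClosure_add_one_le_of_ssubset hPd hQd
    (ne_zero_of_isNonsingularForm hP) hQ0 hsub hne'
  rw [affineDimension_orbitClosure_of_isNonsingularForm hP hPd hd,
    affineDimension_orbitClosure_eq_card_sq_sub_finrank_glAnn hQd, Fintype.card_fin] at hlt
  omega

/-- **A form degenerating to a smooth form of degree `≥ 3` has a finite stabiliser itself**: if a
nonsingular `P` of degree `d ≥ 3` lies in `Δ(Q)` (`Q ≠ 0` of degree `d`), then `𝔤𝔩(W)_Q = 0`
(`dim Δ(Q) = dim Δ(P) = (n+2)²` forces `dim 𝔤𝔩(W)_Q = 0`). [cite: Poonen2005, Thm. 2 (p0002:L9);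
corollary, not in the source] -/
theorem glAnn_eq_bot_of_isNonsingularForm_mem_orbitClosure {P Q : MvPolynomial (Fin (n + 2)) ℂ}
    (hP : IsNonsingularForm ℂ P) {d : ℕ} (hPd : P.IsHomogeneous d) (hd : 3 ≤ d)
    (hQd : Q.IsHomogeneous d) (hQ0 : Q ≠ 0) (h : P ∈ orbitClosure Q) : glAnn Q = ⊥ := by
  have heq := orbitClosure_eq_of_mem_of_isNonsingularForm hP hPd hd hQd hQ0 h
  have hdimP := affineDimension_orbitClosure_of_isNonsingularForm hP hPd hd
  rw [heq, affineDimension_orbitClosure_eq_card_sq_sub_finrank_glAnn hQd, Fintype.card_fin] at hdimP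
  have hsum := finrank_glTangent_add_finrank_glAnn Q
  rw [Fintype.card_fin] at hsum
  have h0 : Module.finrank ℂ (glAnn Q) = 0 := by omega
  exact Submodule.finrank_eq_zero.mp h0

/-- Contrapositive: **orbit closures of forms with a positive-dimensional stabiliser Lie algebra
contain no smooth forms of degree `≥ 3`** (e.g. no nonsingular form is a degeneration of a form
with `𝔤𝔩(W)_Q ≠ 0`, such as a padded or highly symmetric form). [cite: Poonen2005, Thm. 2
(p0002:L9); corollary, not in the source] -/
theorem not_mem_orbitClosure_of_glAnn_ne_bot {P Q : MvPolynomial (Fin (n + 2)) ℂ}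
    (hP : IsNonsingularForm ℂ P) {d : ℕ} (hPd : P.IsHomogeneous d) (hd : 3 ≤ d)
    (hQd : Q.IsHomogeneous d) (hQ : glAnn Q ≠ ⊥) : P ∉ orbitClosure Q := by
  intro h
  rcases eq_or_ne Q 0 with rfl | hQ0
  · -- `Δ(0) = {0}` contains no nonsingular form: `P ∈ Δ(0)` forces `P = 0`
    have hsub : orbitClosure P ⊆ orbitClosure (0 : MvPolynomial (Fin (n + 2)) ℂ) :=
      orbitClosure_subset_of_mem_holds h
    have hP0 : P ≠ 0 := ne_zero_of_isNonsingularForm hP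
    -- the coordinate functions vanish on `GL·0 = {0}`, hence on `Δ(0) ∋ P`
    apply hP0
    have hmem := hsub (mem_orbitClosure_self P)
    rw [mem_orbitClosure_iff] at hmem
    ext m
    have := hmem (MvPolynomial.X m) (fun g hg => by
      obtain ⟨A, rfl⟩ := hg
      simp [coeffVec])
    simpa [coeffVec] using this
  · exact hQ (glAnn_eq_bot_of_isNonsingularForm_mem_orbitClosure hP hPd hd hQd hQ0 h)

end Smooth

end Literature.Computability.AlgebraicComplexity

end
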